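import Literature.Analysis.FunctionSpaces.TorusFourierSeries
import Literature.Analysis.FunctionSpaces.TorusFourierCalculus
import HarnessLib

/-!
# Scalar- (and Banach-) valued smooth functions on `T^d`: coefficient decay, summability, expansion

Analysis/FunctionSpaces support file (everything proved). `TorusFourierCalculus` gives the
recursion `𝓕(∂ⱼ g)(k) = (2πi kⱼ) • 𝓕g(k)` (`Torus.mFourierCoeff_partialDeriv`) for smooth `g`
with values in any complex normed space, and `TorusFourierSeries` derives absolute summability of
the coefficients for smooth REAL VECTOR FIELDS `UnitAddTorus d → EuclideanSpace ℝ d` (the shape of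
the Navier–Stokes files). This file records the elementary consequences for a smooth `g` with
values in a complete complex normed space `F` (in particular `F = ℂ`, the case of harmonic analysis
on the unit torus of a number field: Hecke 1920, Mitsui 1956):

* `Torus.isSmooth_partialDeriv_iterate`, `Torus.mFourierCoeff_partialDeriv_iterate` — `𝓕(∂ⱼ^m g)(k) = (2πi kⱼ)^m • 𝓕g(k)`;
* `Torus.norm_mFourierCoeff_le_of_partialDeriv_iterate` — **`‖𝓕g(k)‖ ≤ sup ‖∂ⱼ^m g‖/(2π|kⱼ|)^m`**;
* `Torus.summable_norm_mFourierCoeff_scalar` — **`∑_k ‖𝓕g(k)‖ < ∞`** for smooth `g`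
  (bound by `D ∏ⱼ 2(1 + kⱼ²)⁻¹` with `m = 2#d` derivatives, `summable_pi_prod_weight`);
* `Torus.hasSum_mFourier_scalar` — `g(x) = ∑_k 𝓕g(k) e_k(x)` pointwise for smooth scalar `g`
  (Mathlib's `UnitAddTorus.hasSum_mFourier_series_apply_of_summable`).

## References

* L. Grafakos, *Classical Fourier Analysis*, 3rd ed. (2014), Thm. 3.3.9 and §3.3.3 (decay of the
  coefficients of smooth functions; absolutely convergent Fourier series). [cite: Grafakos2014, Thm. 3.3.9]
* E. M. Stein, G. Weiss, *Introduction to Fourier Analysis on Euclidean Spaces* (1971), Ch. VII §1. [folklore]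

## Mathlib / tree search

Tree: `Torus.mFourierCoeff_partialDeriv`, `Torus.IsSmooth.partialDeriv`, `Torus.IsSmooth.continuous`,
`Torus.norm_mFourierCoeff_le_of_forall_norm_le`, `Torus.summable_inv_one_add_sq_int`
(`TorusFourierSeries`, vector-field summability `summable_norm_mFourierCoeff_of_isSmooth` only).
Mathlib: `UnitAddTorus.hasSum_mFourier_series_apply_of_summable`; no decay statement.
-/

noncomputable section

open MeasureTheory Set Filter Topology UnitAddTorus
open scoped ContDiff

namespace Literature.Analysis.FunctionSpaces

namespace Torus

variable {d : Type*} [Fintype d] [DecidableEq d]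
variable {F : Type*} [NormedAddCommGroup F] [NormedSpace ℂ F]

/-! ## Iterating the derivative recursion -/

/-- Iterated partial derivatives of a smooth function are smooth. [folklore] -/
theorem isSmooth_partialDeriv_iterate {g : UnitAddTorus d → F} (hg : IsSmooth g) (j : d) (m : ℕ) :
    IsSmooth ((Torus.partialDeriv j)^[m] g) := by
  induction m with
  | zero => exact hg
  | succ m ih => rw [Function.iterate_succ', Function.comp_apply]; exact IsSmooth.partialDeriv ih j

/-- **`𝓕(∂ⱼ^m g)(k) = (2πi kⱼ)^m • 𝓕g(k)`.** [cite: Grafakos2014, Thm. 3.3.9] -/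
theorem mFourierCoeff_partialDeriv_iterate [CompleteSpace F] {g : UnitAddTorus d → F} (hg : IsSmooth g) (j : d) (m : ℕ)
    (k : d → ℤ) :
    mFourierCoeff ((partialDeriv j)^[m] g) k = (2 * Real.pi * Complex.I * (k j)) ^ m • mFourierCoeff g k := by
  induction m with
  | zero => simp
  | succ m ih =>
    rw [Function.iterate_succ', Function.comp_apply, mFourierCoeff_partialDeriv (isSmooth_partialDeriv_iterate hg j m), ih, smul_smul,
      pow_succ, mul_comm]

/-- **Decay**: `‖𝓕g(k)‖ ≤ D / (2π|kⱼ|)^m` whenever `‖∂ⱼ^m g‖ ≤ D` everywhere and `kⱼ ≠ 0`.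
[cite: Grafakos2014, Thm. 3.3.9] -/
theorem norm_mFourierCoeff_le_of_partialDeriv_iterate [CompleteSpace F] {g : UnitAddTorus d → F} (hg : IsSmooth g)
    (j : d) (m : ℕ) {k : d → ℤ} (hk : k j ≠ 0) {D : ℝ} (hD : ∀ x, ‖((partialDeriv j)^[m] g) x‖ ≤ D) :
    ‖mFourierCoeff g k‖ ≤ D / (2 * Real.pi * |(k j : ℝ)|) ^ m := by
  have h := norm_mFourierCoeff_le_of_forall_norm_le hD k
  rw [mFourierCoeff_partialDeriv_iterate hg j m k, norm_smul, norm_pow] at h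
  have hc : ‖2 * Real.pi * Complex.I * (k j : ℂ)‖ = 2 * Real.pi * |(k j : ℝ)| := by
    rw [norm_mul, norm_mul, norm_mul, Complex.norm_I, mul_one, Complex.norm_intCast, Complex.norm_real, Real.norm_eq_abs,
      Complex.norm_ofNat, abs_of_pos Real.pi_pos]
  rw [hc] at h
  have hpos : 0 < (2 * Real.pi * |(k j : ℝ)|) ^ m := by
    have : 0 < |(k j : ℝ)| := abs_pos.2 (by exact_mod_cast hk)
    positivity
  rw [le_div_iff₀ hpos, mul_comm]
  exact h

/-! ## Summability -/

omit [Fintype d] [DecidableEq d] in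
/-- Products of a non-negative summable weight over `Fin n` coordinates are summable. [folklore] -/
theorem summable_fin_prod_weight {w : ℤ → ℝ} (hw : Summable w) (hw0 : 0 ≤ w) (n : ℕ) :
    Summable fun k : Fin n → ℤ => ∏ a, w (k a) := by
  induction n with
  | zero => exact summable_of_hasFiniteSupport (Set.toFinite _)
  | succ n ih =>
    have h2 := Summable.mul_of_nonneg hw ih hw0 (fun k => Finset.prod_nonneg fun a _ => hw0 _)
    refine (Equiv.summable_iff (f := fun k : Fin (n + 1) → ℤ => ∏ a, w (k a)) (Fin.consEquiv fun _ : Fin (n + 1) => ℤ)).1 ?_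
    refine h2.congr fun p => ?_
    simp [Fin.consEquiv, Fin.prod_univ_succ]

omit [DecidableEq d] in
/-- Products of a non-negative summable weight over the coordinates are summable on `d → ℤ`.
[folklore] -/
theorem summable_pi_prod_weight {w : ℤ → ℝ} (hw : Summable w) (hw0 : 0 ≤ w) :
    Summable fun k : d → ℤ => ∏ a, w (k a) := by
  have h := summable_fin_prod_weight hw hw0 (Fintype.card d)
  set e := Fintype.equivFin d with he
  have h2 := h.comp_injective (Equiv.piCongrLeft' (fun _ : d => ℤ) e).injective
  refine h2.congr fun k => ?_
  simp only [Function.comp_apply]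
  rw [← e.symm.prod_comp]
  rfl

omit [Fintype d] [DecidableEq d] in
/-- `max(1,|m|)^{-2} ≤ 2 (1+m²)^{-1}`. [folklore] -/
theorem inv_max_sq_le_two_mul (m : ℤ) : ((max 1 |(m : ℝ)|) ^ 2)⁻¹ ≤ 2 * (1 + (m : ℝ) ^ 2)⁻¹ := by
  have h1 : (1 : ℝ) ≤ max 1 |(m : ℝ)| := le_max_left _ _
  have h2 : |(m : ℝ)| ≤ max 1 |(m : ℝ)| := le_max_right _ _
  rw [show (2 : ℝ) * (1 + (m : ℝ) ^ 2)⁻¹ = ((1 + (m : ℝ) ^ 2) / 2)⁻¹ by rw [inv_div]; ring]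
  rw [inv_le_inv₀ (by positivity) (by positivity)]
  nlinarith [abs_nonneg (m : ℝ), sq_abs (m : ℝ)]

/-- **Absolute summability of the Fourier coefficients of a smooth function on `T^d`** with values
in a complete complex normed space. [cite: Grafakos2014, §3.3.3] -/
theorem summable_norm_mFourierCoeff_scalar [CompleteSpace F] {g : UnitAddTorus d → F} (hg : IsSmooth g) :
    Summable fun k : d → ℤ => ‖mFourierCoeff g k‖ := by
  set K : ℕ := 2 * Fintype.card d with hK
  -- uniform bounds on the compact torus
  have hbdd : ∀ (h : UnitAddTorus d → F), Continuous h → ∃ C, 0 ≤ C ∧ ∀ x, ‖h x‖ ≤ C := by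
    intro h hh
    obtain ⟨C, hC⟩ := (isCompact_univ.image hh).isBounded.exists_norm_le
    exact ⟨max C 0, le_max_right _ _, fun x => (hC _ ⟨x, trivial, rfl⟩).trans (le_max_left _ _)⟩
  obtain ⟨D₀, hD₀0, hD₀⟩ := hbdd g hg.continuous
  choose Dj hDj0 hDj using fun j : d => hbdd _ (isSmooth_partialDeriv_iterate hg j K).continuous
  set D : ℝ := D₀ + ∑ j, Dj j with hD
  have hD0 : 0 ≤ D := by rw [hD]; exact add_nonneg hD₀0 (Finset.sum_nonneg fun j _ => hDj0 j)
  have hDf : D₀ ≤ D := by rw [hD]; exact le_add_of_nonneg_right (Finset.sum_nonneg fun j _ => hDj0 j)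
  have hDi : ∀ j, Dj j ≤ D := fun j => by
    rw [hD]
    exact le_add_of_nonneg_of_le hD₀0 (Finset.single_le_sum (f := Dj) (fun i _ => hDj0 i) (Finset.mem_univ j))
  -- the two basic bounds
  have hb0 : ∀ k, ‖mFourierCoeff g k‖ ≤ D := fun k => (norm_mFourierCoeff_le_of_forall_norm_le hD₀ k).trans hDf
  have hbi : ∀ k (j : d), k j ≠ 0 → ‖mFourierCoeff g k‖ ≤ D / |(k j : ℝ)| ^ K := by
    intro k j hk
    have h := norm_mFourierCoeff_le_of_partialDeriv_iterate hg j K hk (D := D) fun x => (hDj j x).trans (hDi j)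
    refine h.trans (div_le_div_of_nonneg_left hD0 (pow_pos (abs_pos.2 (by exact_mod_cast hk)) _) ?_)
    refine pow_le_pow_left₀ (abs_nonneg _) ?_ K
    have : (1 : ℝ) ≤ 2 * Real.pi := by have := Real.two_le_pi; linarith
    nlinarith [abs_nonneg (k j : ℝ)]
  -- the summable majorant `D 2^{#d} ∏ⱼ (1 + kⱼ²)⁻¹`
  set w : ℤ → ℝ := fun m => (1 + (m : ℝ) ^ 2)⁻¹ with hw
  have hw0 : 0 ≤ w := fun m => by simp only [hw]; positivity
  have hmaj : ∀ k : d → ℤ, ‖mFourierCoeff g k‖ ≤ D * 2 ^ Fintype.card d * ∏ j, w (k j) := by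
    intro k
    by_cases hd : Nonempty d
    · obtain ⟨j₀, -, hj₀⟩ := Finset.exists_max_image Finset.univ (fun j => |(k j : ℝ)|) (Finset.univ_nonempty_iff.2 hd)
      by_cases hk : k j₀ = 0
      · have hk0 : ∀ j, k j = 0 := fun j => by
          have h := hj₀ j (Finset.mem_univ j)
          rw [hk, Int.cast_zero, abs_zero] at h
          exact_mod_cast abs_nonpos_iff.1 h
        have hprod : ∏ j, w (k j) = 1 := Finset.prod_eq_one fun j _ => by rw [hk0 j]; simp [hw]
        rw [hprod, mul_one]
        exact (hb0 k).trans (le_mul_of_one_le_right hD0 (one_le_pow₀ (by norm_num)))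
      · have hN1 : (1 : ℝ) ≤ |(k j₀ : ℝ)| := by
          have : (1 : ℤ) ≤ |k j₀| := Int.one_le_abs hk
          exact_mod_cast this
        have hstep : ∀ j, (|(k j₀ : ℝ)| ^ 2)⁻¹ ≤ 2 * w (k j) := by
          intro j
          refine le_trans ?_ (inv_max_sq_le_two_mul (k j))
          rw [inv_le_inv₀ (by positivity) (by positivity)]
          exact pow_le_pow_left₀ (by positivity) (max_le hN1 (hj₀ j (Finset.mem_univ j))) 2
        calc ‖mFourierCoeff g k‖ ≤ D / |(k j₀ : ℝ)| ^ K := hbi k j₀ hk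
          _ = D * ∏ _j : d, (|(k j₀ : ℝ)| ^ 2)⁻¹ := by
              rw [Finset.prod_const, Finset.card_univ, ← inv_pow, ← pow_mul, hK, div_eq_mul_inv, mul_comm 2, inv_pow]
          _ ≤ D * ∏ j : d, (2 * w (k j)) :=
              mul_le_mul_of_nonneg_left (Finset.prod_le_prod (fun _ _ => by positivity) fun j _ => hstep j) hD0
          _ = D * 2 ^ Fintype.card d * ∏ j, w (k j) := by
              rw [Finset.prod_mul_distrib, Finset.prod_const, Finset.card_univ]; ring
    · have hprod : ∏ j, w (k j) = 1 := by
        rw [Finset.univ_eq_empty_iff.2 (not_nonempty_iff.1 hd), Finset.prod_empty]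
      rw [hprod, mul_one]
      exact (hb0 k).trans (le_mul_of_one_le_right hD0 (one_le_pow₀ (by norm_num)))
  refine Summable.of_nonneg_of_le (fun k => norm_nonneg _) hmaj ?_
  exact (summable_pi_prod_weight summable_inv_one_add_sq_int hw0).mul_left (D * 2 ^ Fintype.card d)

/-- **The pointwise Fourier expansion of a smooth function on `T^d`** (values in `ℂ`):
`g(x) = ∑_k 𝓕g(k) e_k(x)`, absolutely convergent. [cite: Grafakos2014, §3.3.3] -/
theorem hasSum_mFourier_scalar {g : UnitAddTorus d → ℂ} (hg : IsSmooth g) (x : UnitAddTorus d) :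
    HasSum (fun k : d → ℤ => mFourierCoeff g k * mFourier k x) (g x) := by
  have hsum : Summable (mFourierCoeff g) := Summable.of_norm (summable_norm_mFourierCoeff_scalar hg)
  have h := UnitAddTorus.hasSum_mFourier_series_apply_of_summable (f := ⟨g, hg.continuous⟩) hsum x
  simpa only [smul_eq_mul, ContinuousMap.coe_mk] using h

end Torus

end Literature.Analysis.FunctionSpaces
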